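import Mathlib

/-!
# Solo (informed) rung s28/1: the integral two-strand model — forced socles, forced gluing, subfield ranks

Setting (paper §16.13(k)): `F` totally real cubic, `7` inert, `7 ∤ h_F`, standard eigen-pattern,
`K = F(ζ₇)`, `L = K(η^{1/7})`, `G = Gal(L/K)`.  The group ring `ℤ₇[G]` is `R = ℤ₇[X]/(X⁷ + 7X)` with
`X` the `ω`-eigen-generator of the augmentation ideal, and `M = Cl(L)[7^∞]` is a `ℤ/6`-graded
`R`-module (`deg X = 1`) generated by two homogeneous elements `ẽ₃, ẽ₅`; modulo the norm image
`V = νM = j(Cl K)` (`ν = X⁶ + 7`, `XV = 0`) it is a sum of two graded strands `S(3,n₃) ⊕ S(5,n₅)`,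
and the strand ends `w_t = X^{n_t} ẽ_t` lie in `V_{t+n_t}`.  Three finite statements of that
section are certified here.

* `soloInformed_end_is_seven_torsion`: over ANY commutative ring with an element `X` satisfying
  `X⁷ = -7X`, in any module, an element `w = Xⁿ•e` (`n ≥ 1`) killed by `X` is killed by `7`
  (`7Xⁿ = -X^{n+6}`): the strand ends land in the SOCLE `V[7]` of the norm image ((k)(1)(d)).
* `soloInformed_forced_gluing`: `V` lives in degrees `3, 5` only, so an end `w_t ≠ 0` needs
  `t + n_t ≡ 3` or `5 (mod 6)`; for `t ∈ {3,5}`, `1 ≤ n ≤ 12` this happens exactly for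
  `(t, n mod 6) ∈ {(3,0), (3,2), (5,4), (5,0)}`, and the end lands in degree `3` iff
  `(t, n mod 6) ∈ {(3,0), (5,4)}` ((k)(1)(e): `ℓ₃ = 2` glues into `j(C₅)`, `ℓ₅ = 4` into `j(C₃)`).
* `soloInformed_subfield_ranks`: a strand with top degree `t` and length `ℓ` occupies degrees
  `t, t+1, …, t+ℓ-1 (mod 6)`; counting the degrees fixed by `Δ_η²` (`≡ 0, 3`) and by `{±1}` (even)
  gives `rank₇ Cl(E_η) = 1 + [ℓ₃ ≥ 4] + [ℓ₃ = 7] + [ℓ₅ ≥ 2] + [ℓ₅ ≥ 5]` and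
  `rank₇ Cl(K⁺F_η) = ⌊ℓ₃/2⌋ + ⌊ℓ₅/2⌋` for `ℓ₃, ℓ₅ ∈ [1,7]` ((k)(3) R3, R6; (j)(4)).

No axioms beyond Mathlib's; no `sorry`.
-/

namespace Summit.Langlands.Langlands.Theorems

/-- (16.13)(k)(1)(d): if `X⁷ = -7X` in a commutative ring `R`, then in any `R`-module an element of
the form `w = Xⁿ • e` with `n ≥ 1` and `X • w = 0` satisfies `7 • w = 0`
(because `7·Xⁿ = -X⁶·Xⁿ`, so `7w = -X⁶ w = 0`). -/
theorem soloInformed_end_is_seven_torsion {R M : Type*} [CommRing R] [AddCommGroup M] [Module R M]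
    (X : R) (hX : X ^ 7 = -(7 * X)) (e w : M) (n : ℕ) (hn : 1 ≤ n)
    (hw : w = X ^ n • e) (hXw : X • w = 0) : (7 : R) • w = 0 := by
  obtain ⟨m, rfl⟩ : ∃ m, n = m + 1 := ⟨n - 1, by omega⟩
  have h7X : (7 : R) * X = -(X ^ 7) := by rw [hX]; ring
  have h1 : (7 : R) * X ^ (m + 1) = -(X ^ 6 * X ^ (m + 1)) := by
    calc (7 : R) * X ^ (m + 1) = (7 * X) * X ^ m := by ring
      _ = -(X ^ 7) * X ^ m := by rw [h7X]
      _ = -(X ^ 6 * X ^ (m + 1)) := by ring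
  have h2 : X ^ 6 • w = 0 := by
    have h3 : X ^ 6 • w = X ^ 5 • (X • w) := by
      rw [smul_smul]; congr 1; ring
    rw [h3, hXw, smul_zero]
  calc (7 : R) • w = ((7 : R) * X ^ (m + 1)) • e := by rw [hw, ← mul_smul]
    _ = (-(X ^ 6 * X ^ (m + 1))) • e := by rw [h1]
    _ = -(X ^ 6 • (X ^ (m + 1) • e)) := by rw [neg_smul, mul_smul]
    _ = -(X ^ 6 • w) := by rw [hw]
    _ = 0 := by rw [h2, neg_zero]

/-- (16.13)(k)(1)(e), forced gluing: for a strand with top degree `t ∈ {3,5}` and length `n`,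
the end `X^n ẽ_t` sits in degree `t + n (mod 6)`, and the norm image lives in degrees `3, 5` only.
The end can be non-zero exactly when `(t, n mod 6) ∈ {(3,0),(3,2),(5,4),(5,0)}`, and it then lies in
degree `3` (glued into `j(C₃)`) iff `(t, n mod 6) ∈ {(3,0),(5,4)}`, in degree `5` otherwise. -/
theorem soloInformed_forced_gluing :
    ∀ t ∈ ({3, 5} : Finset ℕ), ∀ n ∈ Finset.Icc 1 12,
      (((t + n) % 6 = 3 ∨ (t + n) % 6 = 5) ↔
          ((t = 3 ∧ (n % 6 = 0 ∨ n % 6 = 2)) ∨ (t = 5 ∧ (n % 6 = 4 ∨ n % 6 = 0)))) ∧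
      ((t + n) % 6 = 3 ↔ ((t = 3 ∧ n % 6 = 0) ∨ (t = 5 ∧ n % 6 = 4))) := by
  decide

/-- (16.13)(k)(3) R3/R6 and (j)(4): subfield ranks read off the strand lengths.  A strand with top
degree `t` and length `ℓ` has one basis vector in each degree `t + m (mod 6)`, `0 ≤ m < ℓ`; the
degrees `≡ 0, 3 (mod 6)` are those fixed by `Δ_η²` (the field `E_η = F_η(√-7)`), the even degrees
those fixed by `{±1}` (the field `K⁺F_η`).  For two strands with tops `3, 5` and lengths in `[1,7]`:
`#(deg ∈ {0,3}) = 1 + [ℓ₃ ≥ 4] + [ℓ₃ = 7] + [ℓ₅ ≥ 2] + [ℓ₅ ≥ 5]` and `#(deg even) = ⌊ℓ₃/2⌋ + ⌊ℓ₅/2⌋`. -/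
theorem soloInformed_subfield_ranks :
    ∀ l3 ∈ Finset.Icc 1 7, ∀ l5 ∈ Finset.Icc 1 7,
      ((Finset.range l3).filter (fun m => (3 + m) % 6 = 0 ∨ (3 + m) % 6 = 3)).card
          + ((Finset.range l5).filter (fun m => (5 + m) % 6 = 0 ∨ (5 + m) % 6 = 3)).card
        = 1 + (if 4 ≤ l3 then 1 else 0) + (if l3 = 7 then 1 else 0)
            + (if 2 ≤ l5 then 1 else 0) + (if 5 ≤ l5 then 1 else 0) ∧
      ((Finset.range l3).filter (fun m => (3 + m) % 2 = 0)).card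
          + ((Finset.range l5).filter (fun m => (5 + m) % 2 = 0)).card = l3 / 2 + l5 / 2 := by
  decide

end Summit.Langlands.Langlands.Theorems
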